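import Mathlib

/-!
# Dimock, *The renormalization group according to Balaban* III, §3.3 "small factors": LEMMAS 11–12 (the per-cube
# extraction `exp(−c‖f‖²_P)·ζ(P) ≤ exp(−c p² · #cubes)`), the potential bound (seltzer), LEMMA 13's double-counting step
# (B) and arithmetic steps (D)/(E), and the collection (sangria) — PROVED in abstract finite form

**Citation header (reproduction of PUBLISHED work; template of the Bałaban lattice Yang–Mills cell).**
J. Dimock, *The renormalization group according to Balaban III. Convergence*, Ann. Henri Poincaré **15** (2014)
2133–2175 (= arXiv:1304.0705v1) [Dimock2013BalabanIII], §3.3 "small factors" TeX L1698–2057: LEMMA 11 (the 11th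
`\begin{lem}` under the global counter `\newtheorem{lem}{Lemma}` L16) L1714–1720 with its proof L1724–1748, LEMMA 12
L1768–1773 with its proof L1777–1796, the potential bound (seltzer) L1805–1814, LEMMA 13 (`\label{citizen}`) L1832–1838 with
its proof steps (A)–(H) L1850–2035, and the Remarks L2038–2057 with (sangria) L2053–2055 (TeX source held by the cell,
`inputs/files/dimock/src/1304.0705/1304.0705.tex`, dfd556282834aeba, 2836 lines).  Dimock's papers are published and
refereed and are the cell's TEMPLATE, not manuscripts under audit; no quantity of the Bałaban series is touched.

**What the paper prints (verbatim).**  L1709–1710: *"We split each exponential into two factors exp(−¼aL^{−(𝖭−j−1)}|Φ_{j+1}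
− QΦ_j|²_{Ω^c_{j+1}}). The first is estimated to give small factors and the second is integrated over. Since P_{j+1} ⊂
Ω^c_{j+1} the first is smaller than exp(−¼aL^{−(𝖭−j−1)}|Φ_{j+1} − QΦ_j|²_{P_{j+1}})."*  **LEMMA 11** (L1714–1720):
*"For Φ_j : 𝕋^{−(𝖭−j)}_𝖬 → ℝ and Φ_{j+1} : 𝕋^{−(𝖭−j−1)}_𝖬 → ℝ and P_{j+1} a union of L^{−(𝖭−j−1)}M cubes in 𝕋^{−𝖭}_𝖬:
exp(−¼aL^{−(𝖭−j−1)}|Φ_{j+1} − QΦ_j|²_{P_{j+1}}) ζ^q_{j,L^{−(𝖭−j)}}(P_{j+1}) ≤ exp(−¼aLp_j²M^{−3}|P^{(j+1)}_{j+1}|)"*; proof L1724–1748: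
*"It suffices to prove this back on the lattice where the term was born. … The left side of (scaled1) can be written:
Π_{□⊂P_{j+1}} exp(−¼aL|Φ_{j+1} − QΦ_j|²_□) ζ^q_j(□) where the product is over the LM cubes. The characteristic function
ζ^q_{j+1}(□) enforces that there is at least on point in □ such that |Φ_{j+1} − QΦ_j| ≥ p_j. Therefore exp(−¼aL|Φ_{j+1} −
QΦ_j|²_□) ζ^q_j(□) ≤ exp(−¼aLp_j²)  The result now follows since the number of L-cubes in P_{j+1} is |P^{(j+1)}_{j+1}| so the
number of LM cubes in P_{j+1} is M^{−3}|P^{(j+1)}_{j+1}|."*  **LEMMA 12** (L1768–1773): *"exp(−¼L^{−(𝖭−j)}|W_j|²_{R_{j+1}})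
ζ^w_{j,L^{−(𝖭−j)}}(R_{j+1}) ≤ exp(−¼p²_{0,j}M^{−3}|R^{(j+1)}_{j+1}|)"*; proof L1777–1796: *"… The characteristic function ζ^w_j(□)
enforces that there is at least on point in □ such that |W_j| ≥ p_{0,j}. Therefore exp(−¼|W_j|²_□) ζ^w_j(□) ≤ exp(−¼p²_{0,j})
and the result follows as before."*  (seltzer) L1805–1814: *"We have in general for λ > 0  V(Λ; ε, μ, λ) ≡ ε Vol(Λ) + ½μ∫_Λ φ² +
¼λ∫_Λ φ⁴ ≥ −|ε|Vol(Λ) − ½|μ|∫_Λ φ² + ¼λ∫_Λ φ⁴ ≥ −(|ε| + ¼μ²λ^{−1})Vol(Λ)  The last step follows since −½|μ|x² + ¼λx⁴ has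
the minimum value −¼μ²λ^{−1}."*  **LEMMA 13** (L1832–1838): *"Assume the small field bounds in (sally3). Then there is a
constant c₂ (depending on L) such that for j = 0, …, 𝖭 and δΛ_{j−1} = Λ_{j−1} − Λ_j:  exp(−S^{+,u}_{j,L^{−(𝖭−j)}}(Λ_{j−1} −
Λ_j)) ζ_{j,L^{−(𝖭−j)}}(Q_j) ≤
exp(Cλ_j^β|δΛ^{(j)}_{j−1}| − c₂p²_jM^{−3}|Q^{(j)}_j|)"*; step (B) L1911–1924: *"Ŝ_j(Q*_j) = Σ_{□′⊂Q*_j} Ŝ_j(□′) = Σ_{□′⊂Q*_j}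
Σ_{□: □^{∼R₁}⊃□′} (2R₁+1)^{−3} Ŝ_j(□′) ≥ Σ_{□⊂Q_j} Σ_{□′⊂□^{∼R₁}} (2R₁+1)^{−3} Ŝ_j(□′) = Σ_{□⊂Q_j} (2R₁+1)^{−3} Ŝ_j(□^{∼R₁})  Here
□, □′ are M cubes, and we use that □ ⊂ Q_j and □′ ⊂ □^{∼R₁} imply □′ ⊂ Q*_j and □^{∼R₁} ⊃ □′, so we are summing over a
smaller set"*; L1927–1931: *"Now (snicker2) follows if we can show for □ ⊂ Q_j with R₂ = 2R₁+1  exp(−R₂^{−3}Ŝ_j(□^{∼R₁}))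
ζ_j(□) ≤ exp(−c₂p²_j)  (snicker3)"*; step (D) L1953–1967: *"… ≥ c′₀(‖∂Φ_j‖²_{□^{∼R₁}} + μ̄_j‖Φ_j‖²_{□^{∼R₁}}) ≥ c′₀c₁²p_j²  This is
sufficient to prove (snicker3) if c₂ ≤ c′₀c₁²R₂^{−3}."*  Remark 2 (L2045–2055): *"We collect the small factors generated by the
previous three lemmas. With a further shift of indices and taking account that P₀, R₀, P_{𝖭+1}, Q_{𝖭+1} = ∅ they are
Π_{j=0}^{𝖭+1} exp(−¼aLp²_{j−1}M^{−3}|P^{(j)}_j| − c₂p²_jM^{−3}|Q^{(j)}_j| − ¼p²_{0,j−1}M^{−3}|R^{(j)}_j|)  Assuming c₂ ≤ ¼, ¼aL and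
using p_j ≥ p_{0,j} and that p_{0,j−1} ≥ p_{0,j} this is bounded by Π_{j=0}^{𝖭+1} exp(−c₂p²_{0,j}M^{−3}(|P^{(j)}_j| + |Q^{(j)}_j| +
|R^{(j)}_j|))  (sangria)"*.

**What is reproduced here (kernel-checked, zero `sorry`; Mathlib only).**  ABSTRACT FINITE FORM: the sites form any
type `α`, a region is a finite family `𝒫 : Finset (Finset α)` of pairwise-disjoint cubes (the print's `LM` cubes □ of
`P_{j+1}` resp. `R_{j+1}`), the "field size" is any `f : α → ℝ` (the print's `|Φ_{j+1} − QΦ_j|²(x)` resp. `|W_j(x)|²`).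
* §1 **the characteristic functions**: `zeta 𝒫… ` — `ζ(□) = 1` if *"there is at least one point in □ such that"* `f(x) ≥
  p²`, else `0` (`zetaCube`), and `ζ(P) = Π_□ ζ(□)` (`zetaProd`); `0 ≤ ζ ≤ 1`.
* §2 **LEMMAS 11–12 as one extraction lemma** (`exp_neg_mul_sum_mul_zetaProd_le`): for `c ≥ 0`, `f ≥ 0`,
  `exp(−c·Σ_{x∈⋃𝒫} f(x)) · ζ(P) ≤ exp(−c·p²·|𝒫|)` — per cube `exp(−cΣ_□ f)·ζ(□) ≤ exp(−cp²)` (`exp_neg_mul_sum_mul_zetaCube_le`: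
  the witnessing point carries `f ≥ p²`, the other terms are `≥ 0`), then the product over the cubes (additivity of the
  exponent over the disjoint cubes); the printed instances `lemma11` (`c = ¼aL`, `f = |Φ_{j+1} − QΦ_j|²`) and `lemma12`
  (`c = ¼`, `f = |W_j|²`);
* §3 **(seltzer)**: `quartic_lower_bound` (`−½|μ|x² + ¼λx⁴ ≥ −¼μ²/λ` for `λ > 0`) and `seltzer`
  (`Σ_x w_x(ε + ½μφ(x)² + ¼λφ(x)⁴) ≥ −(|ε| + ¼μ²λ⁻¹)Σ_x w_x` for weights `w ≥ 0` — the print's `∫_Λ`, `Vol(Λ)`);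
* §4 **LEMMA 13, step (B)** (`stepB_double_counting`): for a non-negative cube function `S`, cubes `Q ⊆ Q*` (any
  finite index type) and neighbourhoods `N(□) ⊆ Q*` (`□ ∈ Q`) such that every `□′ ∈ Q*` lies in at most `K` of the `N(□)`,
  `Σ_{□′∈Q*} S(□′) ≥ K⁻¹ Σ_{□∈Q} Σ_{□′∈N(□)} S(□′)` (the print: `N(□) = □^{∼R₁}`, `K = (2R₁+1)³`); and **steps (D)/(E) as
  arithmetic** (`snicker3_of_lower_bound`): if `Ŝ ≥ c′₀c₁²p²` and `c₂ ≤ c′₀c₁²R₂^{−3}` then `exp(−R₂^{−3}Ŝ)·ζ ≤ exp(−c₂p²)` for any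
  `ζ ≤ 1`;
* §5 **Remark 2, (sangria)** (`sangria`): for every level `j` of a finite range, with `c₂ ≤ ¼`, `c₂ ≤ ¼aL`, `p_{0,j} ≤ p_j`,
  `p_{0,j} ≤ p_{0,j−1} ≤ p_{j−1}` and non-negative cube counts, `Π_j exp(−¼aLp²_{j−1}P_j − c₂p²_jQ_j − ¼p²_{0,j−1}R_j) ≤ Π_j
  exp(−c₂p²_{0,j}(P_j + Q_j + R_j))` — the per-level rates `c₂p²_{0,j}` that this lineage's `HistorySum` consumes as the
  (randall) shape;
* §6 instances (two cubes of two sites; a numerical (seltzer)).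

**Readings (declared).**  (i) *"the number of LM cubes in P_{j+1} is M^{−3}|P^{(j+1)}_{j+1}|"* (L1746–1747) is the
cardinality `|𝒫|` of the cube family here; the identification with `M^{−3}|P^{(j+1)}|` (a count of `L`-cubes divided by
`M³`) is the print's bookkeeping of units and is not re-derived.  (ii) The scalings *"It suffices to prove this back on
the lattice where the term was born"* (L1724, L1777, step (A) L1851–1857) are relabellings in the abstract form.  (iii)
The norms `|·|²_□` are unweighted site sums on the unit lattice as printed after scaling (L1728, L1779); a weight can be
absorbed in `f`.

**What is NOT claimed.**  §3.2 "first bounds" (L1551–1694), LEMMA 13's steps (A) (scaling), (C) (the implication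
*"|∂Φ_j| ≤ c₁p_j, |Φ_j| ≤ c₁α_j^{−1}p_j on □^{∼R₁} ⇒ (notable)"*, *"a slight variation of lemma 3.1 in part II"* — part (2.)
of that lemma, random-walk based; this lineage's `SmallFieldBounds` has part (1.) only), (F)–(H) (the case `α_j =
λ_j^{1/4}` via (samsum) and `G_{j,Ω}` bounds, `j = 1`, `j = 0`), hence LEMMA 13 itself; the lower bound of step (D) is App. C
LEMMA 20 (this lineage's `BoundBelow`, not re-imported here — step (D) is stated from its conclusion); anything of B1–B16
(TEMPLATE.md §4.3 row «D3 §3.2–3.3» ↔ B10 §D (67)–(71), grade T: *"each large plaquette … forces"* a small factor).  NOT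
summit progress; NOT a statement about any Bałaban paper; NOT continuum; NOT Clay.  Unit `b2b-balaban-template` gen 30
(journal CLAIM D3-SMALL-FACTORS-KERNEL).

**Version.**  v1.0.1 — DOCSTRING-ONLY fold (every declaration and proof byte-identical to v1 p202724, 2026-08-20,
commit eb23dbfde866) of the cross-read XREAD VERDICT journal l.3215 (beta-lit1-g28 on request l.3181: ok CONSISTENT 4∕4,
DOCFIX 1 LOW quote hygiene, INFO 3): D1a — the L1709–1710 quotation now reads as printed ("The first is estimated to
give small factors and the second is integrated over. Since P_{j+1} ⊂ Ω^c_{j+1} the first is smaller than …"; v1 had put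
an editorial "by …" inside the quote marks); D1b — the LEMMA 13 quotation restores "and δΛ_{j−1} = Λ_{j−1} − Λ_j:"
(L1832), which v1 skipped without an ellipsis; I1 — the `sangria` docstring names the extra order hypothesis as the binder
actually used (`p_{0,j} ≤ p_{j−1}`).  I2 (disjointness explicit as `PairwiseDisjoint`) and I3 (a ζ = 0 example) not
acted on.  Unit `b2b-balaban-template` gen 31.
-/

noncomputable section

open Finset Real

namespace Literature.MathematicalPhysics.QuantumFieldTheory.Dimock2011to13.SmallFactors

variable {α : Type*}

/-! ## §1 The large-field characteristic functions `ζ(□)`, `ζ(P)` -/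

/-- `ζ(□) = 1 − χ(□)`: equals `1` iff *"there is at least one point in □ such that"* the field size `f` is `≥ p²` there,
else `0`. [cite: Dimock2013BalabanIII, §3.3 Lemma 11 proof L1738–1740 and Lemma 12 proof L1788–1790 (arXiv:1304.0705v1 TeX)] -/
def zetaCube (f : α → ℝ) (p : ℝ) (B : Finset α) : ℝ := if ∃ x ∈ B, p ^ 2 ≤ f x then 1 else 0

/-- `ζ(P) = Π_{□⊂P} ζ(□)` over the cubes of the region. [cite: Dimock2013BalabanIII, §3.3 L1732–1737 and L1782–1787
(arXiv:1304.0705v1 TeX)] -/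
def zetaProd (f : α → ℝ) (p : ℝ) (cs : Finset (Finset α)) : ℝ := ∏ B ∈ cs, zetaCube f p B

/-- `ζ(□) ∈ {0, 1}`, in particular `0 ≤ ζ(□)`. [cite: Dimock2013BalabanIII, §3.3 L1738–1740 (arXiv:1304.0705v1 TeX)] -/
theorem zetaCube_nonneg (f : α → ℝ) (p : ℝ) (B : Finset α) : 0 ≤ zetaCube f p B := by
  unfold zetaCube; split_ifs <;> norm_num

/-- `ζ(□) ≤ 1`. [cite: Dimock2013BalabanIII, §3.3 L1738–1740 (arXiv:1304.0705v1 TeX)] -/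
theorem zetaCube_le_one (f : α → ℝ) (p : ℝ) (B : Finset α) : zetaCube f p B ≤ 1 := by
  unfold zetaCube; split_ifs <;> norm_num

/-- `0 ≤ ζ(P)`. [cite: Dimock2013BalabanIII, §3.3 L1732–1737 (arXiv:1304.0705v1 TeX)] -/
theorem zetaProd_nonneg (f : α → ℝ) (p : ℝ) (cs : Finset (Finset α)) : 0 ≤ zetaProd f p cs :=
  Finset.prod_nonneg fun B _ => zetaCube_nonneg f p B

/-- `ζ(P) ≤ 1`. [cite: Dimock2013BalabanIII, §3.3 L1732–1737 (arXiv:1304.0705v1 TeX)] -/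
theorem zetaProd_le_one (f : α → ℝ) (p : ℝ) (cs : Finset (Finset α)) : zetaProd f p cs ≤ 1 :=
  Finset.prod_le_one (fun B _ => zetaCube_nonneg f p B) fun B _ => zetaCube_le_one f p B

/-! ## §2 Lemmas 11–12: the per-cube extraction of small factors -/

/-- **ONE CUBE**: `exp(−c Σ_{x∈□} f(x)) · ζ(□) ≤ exp(−c p²)` for `c ≥ 0`, `f ≥ 0` — *"ζ(□) enforces that there is at least one
point in □ such that"* `f ≥ p²` *". Therefore exp(−¼aL|Φ_{j+1} − QΦ_j|²_□) ζ^q_j(□) ≤ exp(−¼aLp_j²)"*.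
[cite: Dimock2013BalabanIII, §3.3 Lemma 11 proof L1738–1745 and Lemma 12 proof L1788–1795 (arXiv:1304.0705v1 TeX)] -/
theorem exp_neg_mul_sum_mul_zetaCube_le {f : α → ℝ} (hf : ∀ x, 0 ≤ f x) {c : ℝ} (hc : 0 ≤ c) (p : ℝ) (B : Finset α) :
    Real.exp (-(c * ∑ x ∈ B, f x)) * zetaCube f p B ≤ Real.exp (-(c * p ^ 2)) := by
  unfold zetaCube
  split_ifs with h
  · obtain ⟨x, hx, hpx⟩ := h
    rw [mul_one, Real.exp_le_exp, neg_le_neg_iff]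
    refine mul_le_mul_of_nonneg_left (hpx.trans ?_) hc
    exact Finset.single_le_sum (fun y _ => hf y) hx
  · rw [mul_zero]; exact (Real.exp_pos _).le

/-- **LEMMAS 11–12 (abstract form)**: for a finite family `cs` of pairwise-disjoint cubes, `c ≥ 0`, `f ≥ 0`:
`exp(−c Σ_{x∈⋃cs} f(x)) · ζ(P) ≤ exp(−c p² |cs|)` — the product of the one-cube bounds over *"the number of LM cubes"*.
[cite: Dimock2013BalabanIII, §3.3 Lemma 11 L1714–1720 with proof L1732–1748, Lemma 12 L1768–1773 with proof L1782–1796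
(arXiv:1304.0705v1 TeX)] -/
theorem exp_neg_mul_sum_mul_zetaProd_le [DecidableEq α] {f : α → ℝ} (hf : ∀ x, 0 ≤ f x) {c : ℝ} (hc : 0 ≤ c) (p : ℝ)
    (cs : Finset (Finset α)) (hdisj : (cs : Set (Finset α)).PairwiseDisjoint id) :
    Real.exp (-(c * ∑ x ∈ cs.biUnion id, f x)) * zetaProd f p cs ≤ Real.exp (-(c * p ^ 2 * cs.card)) := by
  rw [Finset.sum_biUnion hdisj, Finset.mul_sum, ← Finset.sum_neg_distrib, Real.exp_sum, zetaProd,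
    ← Finset.prod_mul_distrib]
  calc ∏ B ∈ cs, Real.exp (-(c * ∑ x ∈ id B, f x)) * zetaCube f p B
      ≤ ∏ _B ∈ cs, Real.exp (-(c * p ^ 2)) :=
        Finset.prod_le_prod (fun B _ => mul_nonneg (Real.exp_pos _).le (zetaCube_nonneg f p B))
          fun B _ => exp_neg_mul_sum_mul_zetaCube_le hf hc p B
    _ = Real.exp (-(c * p ^ 2 * cs.card)) := by
        rw [Finset.prod_const, ← Real.exp_nat_mul]; congr 1; ring

/-- **LEMMA 11** (scaled form (scaled1)): with `f(x) = |Φ_{j+1}(x) − (QΦ_j)(x)|²` on the sites of the `LM` cubes of `P_{j+1}` and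
`c = ¼aL`, `exp(−¼aL|Φ_{j+1} − QΦ_j|²_{P_{j+1}}) ζ^q_j(P_{j+1}) ≤ exp(−¼aLp_j² · #cubes)` (`aL ≥ 0`).
[cite: Dimock2013BalabanIII, §3.3 Lemma 11 L1714–1720, (scaled1) L1727–1730, proof L1732–1748 (arXiv:1304.0705v1 TeX)] -/
theorem lemma11 [DecidableEq α] (Φ' QΦ : α → ℝ) {aL : ℝ} (haL : 0 ≤ aL) (p : ℝ) (cs : Finset (Finset α))
    (hdisj : (cs : Set (Finset α)).PairwiseDisjoint id) :
    Real.exp (-(aL / 4 * ∑ x ∈ cs.biUnion id, (Φ' x - QΦ x) ^ 2))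
        * zetaProd (fun x => (Φ' x - QΦ x) ^ 2) p cs
      ≤ Real.exp (-(aL / 4 * p ^ 2 * cs.card)) :=
  exp_neg_mul_sum_mul_zetaProd_le (fun x => sq_nonneg _) (by positivity) p cs hdisj

/-- **LEMMA 12** (scaled form): with `f(x) = |W_j(x)|²` on the sites of the `LM` cubes of `R_{j+1}` and `c = ¼`,
`exp(−¼|W_j|²_{R_{j+1}}) ζ^w_j(R_{j+1}) ≤ exp(−¼p²_{0,j} · #cubes)`. [cite: Dimock2013BalabanIII, §3.3 Lemma 12 L1768–1773 with
proof L1777–1796 (arXiv:1304.0705v1 TeX)] -/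
theorem lemma12 [DecidableEq α] (W : α → ℝ) (p₀ : ℝ) (cs : Finset (Finset α))
    (hdisj : (cs : Set (Finset α)).PairwiseDisjoint id) :
    Real.exp (-(1 / 4 * ∑ x ∈ cs.biUnion id, W x ^ 2)) * zetaProd (fun x => W x ^ 2) p₀ cs
      ≤ Real.exp (-(1 / 4 * p₀ ^ 2 * cs.card)) :=
  exp_neg_mul_sum_mul_zetaProd_le (fun x => sq_nonneg _) (by norm_num) p₀ cs hdisj

/-! ## §3 The potential bound (seltzer) -/

/-- *"−½|μ|x² + ¼λx⁴ has the minimum value −¼μ²λ^{−1}"* (`λ > 0`; attained at `x² = |μ|/λ`).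
[cite: Dimock2013BalabanIII, §3.3 (seltzer) L1814 (arXiv:1304.0705v1 TeX)] -/
theorem quartic_lower_bound {lam : ℝ} (hlam : 0 < lam) (μ x : ℝ) :
    -(μ ^ 2 / (4 * lam)) ≤ -(|μ| / 2) * x ^ 2 + lam / 4 * x ^ 4 := by
  have key : 0 ≤ lam / 4 * (x ^ 2 - |μ| / lam) ^ 2 := by positivity
  have hexp : lam / 4 * (x ^ 2 - |μ| / lam) ^ 2
      = -(|μ| / 2) * x ^ 2 + lam / 4 * x ^ 4 + μ ^ 2 / (4 * lam) := by
    field_simp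
    rw [← sq_abs μ]
    ring
  linarith [sq_abs μ]

/-- **(seltzer)**: `V(Λ; ε, μ, λ) = εVol(Λ) + ½μ∫_Λφ² + ¼λ∫_Λφ⁴ ≥ −(|ε| + ¼μ²λ^{−1})Vol(Λ)` for `λ > 0` — here with `∫_Λ = Σ_x w_x`
for any non-negative weights (`Vol(Λ) = Σ_x w_x`). [cite: Dimock2013BalabanIII, §3.3 (seltzer) L1805–1814 (arXiv:1304.0705v1
TeX)] -/
theorem seltzer (Λ : Finset α) (w φ : α → ℝ) (hw : ∀ x ∈ Λ, 0 ≤ w x) (ε μ : ℝ) {lam : ℝ} (hlam : 0 < lam) :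
    -((|ε| + μ ^ 2 / (4 * lam)) * ∑ x ∈ Λ, w x)
      ≤ ε * ∑ x ∈ Λ, w x + μ / 2 * ∑ x ∈ Λ, w x * φ x ^ 2 + lam / 4 * ∑ x ∈ Λ, w x * φ x ^ 4 := by
  have hpt : ∀ x ∈ Λ, -((|ε| + μ ^ 2 / (4 * lam)) * w x)
      ≤ ε * w x + μ / 2 * (w x * φ x ^ 2) + lam / 4 * (w x * φ x ^ 4) := by
    intro x hx
    have h1 := quartic_lower_bound hlam μ (φ x)
    have h2 : -|ε| ≤ ε := neg_abs_le ε
    have h3 : -(|μ| / 2) * φ x ^ 2 ≤ μ / 2 * φ x ^ 2 := by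
      have := neg_abs_le μ
      nlinarith [sq_nonneg (φ x)]
    have hw' := hw x hx
    nlinarith
  calc -((|ε| + μ ^ 2 / (4 * lam)) * ∑ x ∈ Λ, w x)
      = ∑ x ∈ Λ, -((|ε| + μ ^ 2 / (4 * lam)) * w x) := by rw [Finset.mul_sum, ← Finset.sum_neg_distrib]
    _ ≤ ∑ x ∈ Λ, (ε * w x + μ / 2 * (w x * φ x ^ 2) + lam / 4 * (w x * φ x ^ 4)) := Finset.sum_le_sum hpt
    _ = ε * ∑ x ∈ Λ, w x + μ / 2 * ∑ x ∈ Λ, w x * φ x ^ 2 + lam / 4 * ∑ x ∈ Λ, w x * φ x ^ 4 := by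
        rw [Finset.sum_add_distrib, Finset.sum_add_distrib, ← Finset.mul_sum, ← Finset.mul_sum, ← Finset.mul_sum]

/-! ## §4 Lemma 13: the double counting of step (B) and the arithmetic of steps (D)/(E) -/

/-- **LEMMA 13, STEP (B) — DOUBLE COUNTING**: cubes `Q ⊆ Q*`, neighbourhoods `N(□) ⊆ Q*` for `□ ∈ Q`, every cube `□′ ∈ Q*`
lying in at most `K` of the `N(□)` (`□ ∈ Q`), and a non-negative cube function `S`:
`K⁻¹ Σ_{□∈Q} Σ_{□′∈N(□)} S(□′) ≤ Σ_{□′∈Q*} S(□′)` — print: `N(□) = □^{∼R₁}`, `K = (2R₁+1)³`, *"Ŝ_j(Q*_j) ≥ Σ_{□⊂Q_j}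
(2R₁+1)^{−3} Ŝ_j(□^{∼R₁}) … we are summing over a smaller set"*. [cite: Dimock2013BalabanIII, §3.3 Lemma 13 proof step (B)
L1908–1924 (arXiv:1304.0705v1 TeX)] -/
theorem stepB_double_counting {β : Type*} [DecidableEq β] (Q Qstar : Finset β) (N : β → Finset β) (S : β → ℝ)
    (hS : ∀ b ∈ Qstar, 0 ≤ S b) (hN : ∀ b ∈ Q, N b ⊆ Qstar) {K : ℕ} (hK : 0 < K)
    (hmult : ∀ b' ∈ Qstar, (Q.filter fun b => b' ∈ N b).card ≤ K) :
    (K : ℝ)⁻¹ * ∑ b ∈ Q, ∑ b' ∈ N b, S b' ≤ ∑ b' ∈ Qstar, S b' := by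
  have hKpos : (0 : ℝ) < K := by exact_mod_cast hK
  rw [inv_mul_le_iff₀ hKpos]
  -- exchange the order of summation: Σ_{b∈Q} Σ_{b'∈N b} S b' = Σ_{b'∈Q*} #{b ∈ Q : b' ∈ N b} · S b'
  have hswap : ∑ b ∈ Q, ∑ b' ∈ N b, S b'
      = ∑ b' ∈ Qstar, ((Q.filter fun b => b' ∈ N b).card : ℝ) * S b' := by
    have h1 : ∀ b ∈ Q, ∑ b' ∈ N b, S b' = ∑ b' ∈ Qstar, if b' ∈ N b then S b' else 0 := by
      intro b hb
      rw [← Finset.sum_filter]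
      congr 1
      ext b'
      simp only [Finset.mem_filter]
      constructor
      · intro h; exact ⟨hN b hb h, h⟩
      · intro h; exact h.2
    rw [Finset.sum_congr rfl h1, Finset.sum_comm]
    refine Finset.sum_congr rfl fun b' _ => ?_
    rw [Finset.card_filter, Nat.cast_sum, Finset.sum_mul]
    refine Finset.sum_congr rfl fun b _ => ?_
    split_ifs <;> simp
  rw [hswap, Finset.mul_sum]
  refine Finset.sum_le_sum fun b' hb' => ?_
  have h := hmult b' hb'
  have hc : ((Q.filter fun b => b' ∈ N b).card : ℝ) ≤ K := by exact_mod_cast h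
  exact mul_le_mul_of_nonneg_right hc (hS b' hb')

/-- **LEMMA 13, STEPS (D)/(E) — the arithmetic**: if the (non-negative, restored) action of the enlarged cube is bounded
below, `Ŝ ≥ c′₀c₁²p²`, then `exp(−R₂^{−3}Ŝ)·ζ ≤ exp(−c₂p²)` for every `ζ ≤ 1` *"if c₂ ≤ c′₀c₁²R₂^{−3}"*.
[cite: Dimock2013BalabanIII, §3.3 Lemma 13 proof (snicker3) L1927–1931, steps (D)–(E) L1953–1975 (arXiv:1304.0705v1 TeX)] -/
theorem snicker3_of_lower_bound {S c₀' c₁ c₂ p R₂ ζ : ℝ} (hR : 0 < R₂) (hS : c₀' * c₁ ^ 2 * p ^ 2 ≤ S)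
    (hc₂ : c₂ ≤ c₀' * c₁ ^ 2 * (R₂ ^ 3)⁻¹) (hζ1 : ζ ≤ 1) :
    Real.exp (-((R₂ ^ 3)⁻¹ * S)) * ζ ≤ Real.exp (-(c₂ * p ^ 2)) := by
  have hR3 : 0 < (R₂ ^ 3)⁻¹ := by positivity
  calc Real.exp (-((R₂ ^ 3)⁻¹ * S)) * ζ ≤ Real.exp (-((R₂ ^ 3)⁻¹ * S)) * 1 :=
        mul_le_mul_of_nonneg_left hζ1 (Real.exp_pos _).le
    _ ≤ Real.exp (-(c₂ * p ^ 2)) := by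
        rw [mul_one, Real.exp_le_exp, neg_le_neg_iff]
        have h1 : c₂ * p ^ 2 ≤ c₀' * c₁ ^ 2 * (R₂ ^ 3)⁻¹ * p ^ 2 := mul_le_mul_of_nonneg_right hc₂ (sq_nonneg p)
        have h2 : c₀' * c₁ ^ 2 * (R₂ ^ 3)⁻¹ * p ^ 2 = (R₂ ^ 3)⁻¹ * (c₀' * c₁ ^ 2 * p ^ 2) := by ring
        rw [h2] at h1
        exact h1.trans (mul_le_mul_of_nonneg_left hS hR3.le)

/-! ## §5 Remark 2: collecting the small factors, (sangria) -/

/-- **(sangria), one level**: with `c₂ ≤ ¼aL`, `c₂ ≤ ¼`, `p_{0,j} ≤ p_{j−1}`, `p_{0,j} ≤ p_j`, `p_{0,j} ≤ p_{0,j−1}`, `0 ≤ p_{0,j}`, `c₂`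
and non-negative cube counts `P, Q, R`:
`−¼aLp²_{j−1}P − c₂p²_jQ − ¼p²_{0,j−1}R ≤ −c₂p²_{0,j}(P + Q + R)`. [cite: Dimock2013BalabanIII, §3.3 Remark 2 L2045–2055
(arXiv:1304.0705v1 TeX)] -/
theorem sangria_exponent {aL c₂ pPrev p p₀ p₀Prev P Q R : ℝ} (hc₂aL : c₂ ≤ aL / 4) (hc₂ : c₂ ≤ 1 / 4)
    (hc₂0 : 0 ≤ c₂) (hp₀ : 0 ≤ p₀) (hpPrev : p₀ ≤ pPrev) (hp : p₀ ≤ p) (hp₀Prev : p₀ ≤ p₀Prev) (hP : 0 ≤ P)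
    (hQ : 0 ≤ Q) (hR : 0 ≤ R) :
    -(aL / 4 * pPrev ^ 2 * P) - c₂ * p ^ 2 * Q - 1 / 4 * p₀Prev ^ 2 * R ≤ -(c₂ * p₀ ^ 2 * (P + Q + R)) := by
  have h1 : c₂ * p₀ ^ 2 ≤ aL / 4 * pPrev ^ 2 :=
    mul_le_mul hc₂aL (pow_le_pow_left₀ hp₀ hpPrev 2) (sq_nonneg _) (by linarith)
  have h2 : c₂ * p₀ ^ 2 ≤ c₂ * p ^ 2 := mul_le_mul_of_nonneg_left (pow_le_pow_left₀ hp₀ hp 2) hc₂0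
  have h3 : c₂ * p₀ ^ 2 ≤ 1 / 4 * p₀Prev ^ 2 :=
    mul_le_mul hc₂ (pow_le_pow_left₀ hp₀ hp₀Prev 2) (sq_nonneg _) (by norm_num)
  nlinarith [mul_le_mul_of_nonneg_right h1 hP, mul_le_mul_of_nonneg_right h2 hQ, mul_le_mul_of_nonneg_right h3 hR]

/-- **(sangria)**: the product over the levels `j = 0, …, 𝖭+1` (any finite index set) of the three families of small
factors is bounded by `Π_j exp(−c₂p²_{0,j}(|P_j| + |Q_j| + |R_j|))` under the printed parameter conditions
(*"Assuming c₂ ≤ ¼, ¼aL and using p_j ≥ p_{0,j} and that p_{0,j−1} ≥ p_{0,j}"*, plus `p_{j−1} ≥ p_{0,j}` — binder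
`hpPrev`, the consequence of the printed `p_{0,j−1} ≥ p_{0,j}` and of `p_{j−1} ≥ p_{0,j−1}` (the printed `p_j ≥ p_{0,j}` one
level down) that the estimate actually uses).
[cite: Dimock2013BalabanIII, §3.3 Remark 2 (sangria) L2045–2055 (arXiv:1304.0705v1 TeX)] -/
theorem sangria {ι : Type*} (J : Finset ι) {aL c₂ : ℝ} (pPrev p p₀ p₀Prev P Q R : ι → ℝ) (hc₂aL : c₂ ≤ aL / 4)
    (hc₂ : c₂ ≤ 1 / 4) (hc₂0 : 0 ≤ c₂) (hp₀ : ∀ j ∈ J, 0 ≤ p₀ j) (hpPrev : ∀ j ∈ J, p₀ j ≤ pPrev j)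
    (hp : ∀ j ∈ J, p₀ j ≤ p j) (hp₀Prev : ∀ j ∈ J, p₀ j ≤ p₀Prev j) (hP : ∀ j ∈ J, 0 ≤ P j) (hQ : ∀ j ∈ J, 0 ≤ Q j)
    (hR : ∀ j ∈ J, 0 ≤ R j) :
    ∏ j ∈ J, Real.exp (-(aL / 4 * pPrev j ^ 2 * P j) - c₂ * p j ^ 2 * Q j - 1 / 4 * p₀Prev j ^ 2 * R j)
      ≤ ∏ j ∈ J, Real.exp (-(c₂ * p₀ j ^ 2 * (P j + Q j + R j))) := by
  refine Finset.prod_le_prod (fun j _ => (Real.exp_pos _).le) fun j hj => ?_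
  rw [Real.exp_le_exp]
  exact sangria_exponent hc₂aL hc₂ hc₂0 (hp₀ j hj) (hpPrev j hj) (hp j hj) (hp₀Prev j hj) (hP j hj) (hQ j hj) (hR j hj)

/-! ## §6 Instances -/

/-- two disjoint cubes `{0,1}`, `{2,3}` of `ℕ`, field size `f ≡ 4 ≥ p² = 4` on both: every `ζ(□) = 1`, and the extraction
lemma gives `exp(−c·16)·1 ≤ exp(−c·4·2)`. -/
example (c : ℝ) (hc : 0 ≤ c) :
    Real.exp (-(c * ∑ x ∈ ({({0, 1} : Finset ℕ), {2, 3}} : Finset (Finset ℕ)).biUnion id, (fun _ => (4 : ℝ)) x))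
        * zetaProd (fun _ => (4 : ℝ)) 2 {({0, 1} : Finset ℕ), {2, 3}}
      ≤ Real.exp (-(c * 2 ^ 2 * (({({0, 1} : Finset ℕ), {2, 3}} : Finset (Finset ℕ)).card))) := by
  refine exp_neg_mul_sum_mul_zetaProd_le (fun _ => by norm_num) hc 2 _ ?_
  intro A hA B hB hAB
  simp only [Finset.coe_insert, Finset.coe_singleton, Set.mem_insert_iff, Set.mem_singleton_iff] at hA hB
  rcases hA with rfl | rfl <;> rcases hB with rfl | rfl <;> first | exact absurd rfl hAB | decide

/-- (seltzer) with `ε = 0`, `μ = −2`, `λ = 1`, one site of weight `1`, `φ = 1`: `−1 ≤ 0 − 1 + ¼`. -/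
example : -((|(0 : ℝ)| + (-2) ^ 2 / (4 * 1)) * ∑ x ∈ ({0} : Finset ℕ), (fun _ => (1 : ℝ)) x)
    ≤ 0 * ∑ x ∈ ({0} : Finset ℕ), (fun _ => (1 : ℝ)) x
      + (-2) / 2 * ∑ x ∈ ({0} : Finset ℕ), (fun _ => (1 : ℝ)) x * (fun _ => (1 : ℝ)) x ^ 2
      + 1 / 4 * ∑ x ∈ ({0} : Finset ℕ), (fun _ => (1 : ℝ)) x * (fun _ => (1 : ℝ)) x ^ 4 :=
  seltzer {0} (fun _ => 1) (fun _ => 1) (fun _ _ => zero_le_one) 0 (-2) one_pos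

end Literature.MathematicalPhysics.QuantumFieldTheory.Dimock2011to13.SmallFactors

end
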